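import Literature.AnabelianGeometry.SemiGraphs.CoveringGraphHypothesesBasic
import Literature.AnabelianGeometry.SemiGraphs.OrbitGraph
import Literature.AnabelianGeometry.SemiGraphs.TemperedCoveringsComponentsProofs
import Mathlib.Tactic.Group
import HarnessLib

/-!
# Aloofness and estrangement are hereditary for covering semi-graphs of anabelioids (route T, T7b)

Mochizuki, *Semi-graphs of anabelioids*, Publ. RIMS **42** (2006), §2, Remark 2.4.1, manuscript p. 26
[cite: MochizukiSemiAnbd2006, Rmk 2.4.1 p.26]: "one verifies easily that if `𝒢' → 𝒢` is a finite étale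
covering, and … `e'` … is a(n) … edge of `𝒢'` that maps to a(n) … aloof edge `e` (respectively,
estranged edge `e`) of `𝒢`, then … `e'` … is itself … aloof (respectively, estranged)".  Here for the
covering semi-graph of anabelioids `G_S → G` (`CovObj.coveringGraph`, the local presentation of §3
Def. 3.5 (i), p. 37) of ANY object `S` of `B^cov(G)` — finite or tempered: the constituents of `G_S`
are the open stabilisers `Stab_{Π_v}(s)`, `Stab_{Π_e}(s)` and its branch homomorphisms are the
restrictions of the `b_*` transported along the chosen incidence conjugators `g_{b'}`
(`CovObj.coveringBrHom`).

PROOF-ONLY companion (abc-iut cell, L3 route T, brick T7b of abc-iut-L3-d6's plan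
`SHAPES-T7-HereditaryHypotheses.md`, fields F8/F9; seat abc-iut-L3-t5).  Route:
* SIDE CONDITION TRANSFER (`coveringBranch_eq_and_mem_of_conj_mem`): for two branch-orbits `(b, ω)`,
  `(b, ω')` of the SAME base branch abutting to the vertex-orbit `(v, ω_v)` and `g ∈ Stab_{Π_v}(s_{ω_v})`,
  if `g_{(b,ω)}⁻¹ · g · g_{(b,ω')}` lies in `Π_b = b_*(Π_e)` then `ω' = ω` and `g` lies in the branch group
  of `(b, ω)` — by the `b_*`-equivariance and injectivity of the gluing `S_e ≅ b^* S_v`;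
* hence the downstairs side condition "`β' ≠ β` or `g ∉ Π_β`" implies the upstairs one for
  `g₀ := g_β⁻¹ g g_{β'}` (`base_side_condition`), and the downstairs branch groups sit inside the
  `g_β`-, `g g_{β'}`-conjugates of `Π_b`, `Π_{b'}` (`coe_mem_conj_branchSubgroup_of_mem`,
  `coe_mem_conj_branchSubgroup_of_mem_map_conj`);
* ESTRANGED (`isTotallyEstranged_coveringGraph`): trivial intersections descend along the injective
  inclusion `Stab ↪ Π_v`; ALOOF (`isTotallyAloof_coveringGraph`): infinite relative index descends
  because the downstairs branch group has FINITE index in the conjugate of `Π_b` (the stabiliser is open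
  in the compact `Π_e`) — `relIndex` bookkeeping.
No definition; no statement of the paper retyped; nothing here bears on [IUTchIII] Cor. 3.12.
-/

namespace Literature.AnabelianGeometry.SemiGraphs

namespace ProfiniteSemiGraph

namespace CovObj

open Literature.AlgebraicGeometry.Frobenioids.QuasiTemperoid.BTempConnected (ρ_mul_apply ρ_inv_apply)

universe u

variable {𝒢 : ProfiniteSemiGraph.{u}} (S : CovObj 𝒢)

/-! ### Local helpers -/

/-- An open subgroup of a compact group has non-zero (i.e. finite) index. [folklore] -/
private theorem index_ne_zero_of_isOpen {G : Type*} [Group G] [TopologicalSpace G]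
    [IsTopologicalGroup G] [CompactSpace G] (H : Subgroup G) (hH : IsOpen (H : Set G)) :
    H.index ≠ 0 := by
  haveI : DiscreteTopology (G ⧸ H) := QuotientGroup.discreteTopology_iff.mpr hH
  haveI : Finite (G ⧸ H) := finite_of_compact_of_discrete
  exact Subgroup.index_ne_zero_of_finite

/-- Relative index bookkeeping: if `H` has infinite relative index in `K` and `K₁ ≤ K` has finite
relative index in `K`, then `H` has infinite relative index in `K₁`. [folklore] -/
private theorem relIndex_eq_zero_of_finite_sub {G : Type*} [Group G] {H K K₁ : Subgroup G}
    (hHK : H.relIndex K = 0) (hK₁ : K₁ ≤ K) (hfin : K₁.relIndex K ≠ 0) : H.relIndex K₁ = 0 := by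
  by_contra hne
  have hmul := Subgroup.relIndex_mul_relIndex (H ⊓ K₁) K₁ K inf_le_right hK₁
  rw [Subgroup.inf_relIndex_right] at hmul
  have hzero : (H ⊓ K₁).relIndex K = 0 := Subgroup.relIndex_eq_zero_of_le_left inf_le_left hHK
  rw [hzero] at hmul
  exact mul_ne_zero hne hfin hmul

/-! ### The branch groups of `G_S` inside `Π_v` -/

section Branches

variable {b : 𝒢.graph.Branch} {ω : BTemp.Orbits (S.SE (𝒢.graph.edgeOf b))}
  {v : 𝒢.graph.Vertex} {ωv : BTemp.Orbits (S.SV v)}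

/-- The value of a branch homomorphism of `G_S` in `Π_v`: `k ↦ g_{b'} · b_*(k) · g_{b'}⁻¹`.
[cite: MochizukiSemiAnbd2006, Def 3.5(i) p.37] -/
theorem coe_coveringBrHom (h : S.coveringSemiGraph.abuts ⟨b, ω⟩ = some ⟨v, ωv⟩)
    (k : BTemp.stab (S.SE (𝒢.graph.edgeOf b)) (Quot.out ω)) :
    ((S.coveringBrHom h k : BTemp.stab (S.SV v) (Quot.out ωv)) : 𝒢.Gv v) =
      S.conjugator h * 𝒢.brHom b v (S.abuts_of_coveringAbuts h) k * (S.conjugator h)⁻¹ := rfl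

/-- An element of the branch group of `G_S` at `(b, ω) ↦ (v, ω_v)` lies, as an element of `Π_v`, in the
`g_{(b,ω)}`-conjugate of `Π_b`. [cite: MochizukiSemiAnbd2006, Rmk 2.4.1 p.26] -/
theorem coe_mem_conj_branchSubgroup_of_mem (h : S.coveringSemiGraph.abuts ⟨b, ω⟩ = some ⟨v, ωv⟩)
    {x : BTemp.stab (S.SV v) (Quot.out ωv)}
    (hx : x ∈ S.coveringGraph.branchSubgroup ⟨b, ω⟩ ⟨v, ωv⟩ h) :
    (S.conjugator h)⁻¹ * (x : 𝒢.Gv v) * S.conjugator h ∈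
      𝒢.branchSubgroup b v (S.abuts_of_coveringAbuts h) := by
  obtain ⟨k, rfl⟩ := hx
  refine ⟨(k : 𝒢.Ge (𝒢.graph.edgeOf b)), ?_⟩
  change 𝒢.brHom b v _ k = (S.conjugator h)⁻¹ * (S.coveringBrHom h k : 𝒢.Gv v) * S.conjugator h
  rw [coe_coveringBrHom]
  group

/-- The image in `Π_v` of the branch group of `G_S` at `(b, ω) ↦ (v, ω_v)` has FINITE relative index in
the `g_{(b,ω)}`-conjugate of `Π_b` (the stabiliser of a point of `S_e` is open, hence of finite index,
in the compact `Π_e`). [cite: MochizukiSemiAnbd2006, Rmk 2.4.1 p.26] -/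
theorem relIndex_map_branchSubgroup_ne_zero (h : S.coveringSemiGraph.abuts ⟨b, ω⟩ = some ⟨v, ωv⟩) :
    ((S.coveringGraph.branchSubgroup ⟨b, ω⟩ ⟨v, ωv⟩ h).map
        (BTemp.stab (S.SV v) (Quot.out ωv)).subtype).relIndex
      ((𝒢.branchSubgroup b v (S.abuts_of_coveringAbuts h)).map
        (MulAut.conj (S.conjugator h)).toMonoidHom) ≠ 0 := by
  set θ := S.conjugator h
  set f := (𝒢.brHom b v (S.abuts_of_coveringAbuts h)).toMonoidHom
  set T := BTemp.stab (S.SE (𝒢.graph.edgeOf b)) (Quot.out ω)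
  -- the downstairs image is `conj θ (f (T))`
  have himg : (S.coveringGraph.branchSubgroup ⟨b, ω⟩ ⟨v, ωv⟩ h).map
      (BTemp.stab (S.SV v) (Quot.out ωv)).subtype = (T.map f).map (MulAut.conj θ).toMonoidHom := by
    ext y
    constructor
    · rintro ⟨x, ⟨k, rfl⟩, rfl⟩
      exact ⟨f k, ⟨k, k.2, rfl⟩, (S.coe_coveringBrHom h k).symm⟩
    · rintro ⟨_, ⟨k, hk, rfl⟩, rfl⟩
      exact ⟨S.coveringBrHom h ⟨k, hk⟩, ⟨⟨k, hk⟩, rfl⟩, S.coe_coveringBrHom h ⟨k, hk⟩⟩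
  rw [himg, show 𝒢.branchSubgroup b v (S.abuts_of_coveringAbuts h) = (⊤ : Subgroup _).map f from
    (MonoidHom.range_eq_map f), Subgroup.relIndex_map_map_of_injective _ _
      (MulAut.conj θ).injective, Subgroup.relIndex_map_map, top_sup_eq, Subgroup.relIndex_top_right]
  refine fun h0 => index_ne_zero_of_isOpen T ((S.SE (𝒢.graph.edgeOf b)).property.2 _) ?_
  exact Nat.eq_zero_of_zero_dvd (h0 ▸ Subgroup.index_dvd_of_le le_sup_left)

/-- SIDE CONDITION TRANSFER: two branch-orbits `(b, ω)`, `(b, ω')` of the same base branch abutting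
to `(v, ω_v)`, `g ∈ Stab_{Π_v}(s_{ω_v})`; if `g_{(b,ω)}⁻¹ g g_{(b,ω')} = b_*(k)` for some `k ∈ Π_e` then
`ω' = ω` and `g` lies in the branch group of `(b, ω)` (equivariance and injectivity of the gluing).
[cite: MochizukiSemiAnbd2006, Rmk 2.4.1 p.26] -/
theorem coveringBranch_eq_and_mem_of_conj_mem {ω' : BTemp.Orbits (S.SE (𝒢.graph.edgeOf b))}
    (h : S.coveringSemiGraph.abuts ⟨b, ω⟩ = some ⟨v, ωv⟩)
    (h' : S.coveringSemiGraph.abuts ⟨b, ω'⟩ = some ⟨v, ωv⟩)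
    (g : BTemp.stab (S.SV v) (Quot.out ωv)) (k : 𝒢.Ge (𝒢.graph.edgeOf b))
    (hk : (S.conjugator h)⁻¹ * (g : 𝒢.Gv v) * S.conjugator h' =
      𝒢.brHom b v (S.abuts_of_coveringAbuts h) k) :
    (⟨b, ω'⟩ : S.coveringSemiGraph.Branch) = ⟨b, ω⟩ ∧
      g ∈ S.coveringGraph.branchSubgroup ⟨b, ω⟩ ⟨v, ωv⟩ h := by
  have hb : 𝒢.graph.abuts b = some v := S.abuts_of_coveringAbuts h
  set θ := S.conjugator h with hθ
  set θ' := S.conjugator h' with hθ'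
  have e1 : (S.SV v).obj.ρ θ ((S.glue b v hb).hom.hom.hom (Quot.out ω)) = Quot.out ωv :=
    S.conjugator_spec h
  have e2 : (S.SV v).obj.ρ θ' ((S.glue b v hb).hom.hom.hom (Quot.out ω')) = Quot.out ωv :=
    S.conjugator_spec h'
  have hg : (S.SV v).obj.ρ (g : 𝒢.Gv v) (Quot.out ωv) = Quot.out ωv := g.2
  -- `b_*(k) · glue(s_{ω'}) = glue(s_ω)`
  have hkey : (S.SV v).obj.ρ (𝒢.brHom b v hb k) ((S.glue b v hb).hom.hom.hom (Quot.out ω')) =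
      (S.glue b v hb).hom.hom.hom (Quot.out ω) := by
    rw [← hk, ρ_mul_apply, ρ_mul_apply, e2, hg, ← e1, ρ_inv_apply]
  -- hence `k · s_{ω'} = s_ω`
  have hks : (S.SE (𝒢.graph.edgeOf b)).obj.ρ k (Quot.out ω') = Quot.out ω := by
    apply S.glue_hom_injective b v hb
    change (S.glue b v hb).hom.hom.hom _ = (S.glue b v hb).hom.hom.hom _
    rw [S.glue_ρ b v hb k (Quot.out ω'), hkey]
  have hωω : ω' = ω := by
    rw [← Quot.out_eq ω', ← Quot.out_eq ω]
    change BTemp.cl _ (Quot.out ω') = BTemp.cl _ (Quot.out ω)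
    rw [← BTemp.cl_ρ (S.SE (𝒢.graph.edgeOf b)) k (Quot.out ω'), hks]
  subst hωω
  have hθθ : θ' = θ := rfl
  have hg' : (g : 𝒢.Gv v) = θ * 𝒢.brHom b v hb k * θ⁻¹ := by
    rw [← hk, hθθ]; group
  refine ⟨rfl, ⟨⟨k, hks⟩, Subtype.ext ?_⟩⟩
  change (S.coveringBrHom h ⟨k, hks⟩ : 𝒢.Gv v) = (g : 𝒢.Gv v)
  rw [coe_coveringBrHom, hg']

end Branches

/-! ### The downstairs side condition implies the upstairs one -/

/-- For branch-orbits `β = (b, ω)`, `β' = (b', ω')` abutting to `(v, ω_v)` and `g ∈ Stab_{Π_v}(s_{ω_v})`: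
if `β' ≠ β` or `g` is not in the branch group of `β`, then `b' ≠ b` or
`g₀ := g_β⁻¹ g g_{β'} ∉ Π_b`. [cite: MochizukiSemiAnbd2006, Rmk 2.4.1 p.26] -/
theorem base_side_condition {b b' : 𝒢.graph.Branch} {ω : BTemp.Orbits (S.SE (𝒢.graph.edgeOf b))}
    {ω' : BTemp.Orbits (S.SE (𝒢.graph.edgeOf b'))} {v : 𝒢.graph.Vertex} {ωv : BTemp.Orbits (S.SV v)}
    (h : S.coveringSemiGraph.abuts ⟨b, ω⟩ = some ⟨v, ωv⟩)
    (h' : S.coveringSemiGraph.abuts ⟨b', ω'⟩ = some ⟨v, ωv⟩)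
    (g : BTemp.stab (S.SV v) (Quot.out ωv))
    (hside : (⟨b', ω'⟩ : S.coveringSemiGraph.Branch) ≠ ⟨b, ω⟩ ∨
      g ∉ S.coveringGraph.branchSubgroup ⟨b, ω⟩ ⟨v, ωv⟩ h) :
    b' ≠ b ∨ (S.conjugator h)⁻¹ * (g : 𝒢.Gv v) * S.conjugator h' ∉
      𝒢.branchSubgroup b v (S.abuts_of_coveringAbuts h) := by
  by_cases hbb : b' = b
  · subst hbb
    refine Or.inr fun hmem => ?_
    obtain ⟨k, hk⟩ := hmem
    obtain ⟨hβ, hg⟩ := S.coveringBranch_eq_and_mem_of_conj_mem h h' g k hk.symm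
    rcases hside with hne | hnot
    · exact hne hβ
    · exact hnot hg
  · exact Or.inl hbb

/-! ### Estrangement is hereditary -/

/-- **Estrangement is hereditary** ([SemiAnbd] Rmk. 2.4.1): if `G` is totally estranged then so is
the covering semi-graph of anabelioids `G_S` of every object `S` of `B^cov(G)` — the trivial
intersections descend along `Stab_{Π_v}(s) ↪ Π_v` (the aloofness clause is
`isTotallyAloof_coveringGraph`). [cite: MochizukiSemiAnbd2006, Rmk 2.4.1 p.26] -/
theorem inf_branchSubgroup_map_conj_eq_bot (hE : 𝒢.IsTotallyEstranged)
    {b b' : 𝒢.graph.Branch} {ω : BTemp.Orbits (S.SE (𝒢.graph.edgeOf b))}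
    {ω' : BTemp.Orbits (S.SE (𝒢.graph.edgeOf b'))} {v : 𝒢.graph.Vertex} {ωv : BTemp.Orbits (S.SV v)}
    (h : S.coveringSemiGraph.abuts ⟨b, ω⟩ = some ⟨v, ωv⟩)
    (h' : S.coveringSemiGraph.abuts ⟨b', ω'⟩ = some ⟨v, ωv⟩)
    (g : BTemp.stab (S.SV v) (Quot.out ωv))
    (hside : (⟨b', ω'⟩ : S.coveringSemiGraph.Branch) ≠ ⟨b, ω⟩ ∨
      g ∉ S.coveringGraph.branchSubgroup ⟨b, ω⟩ ⟨v, ωv⟩ h) :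
    S.coveringGraph.branchSubgroup ⟨b, ω⟩ ⟨v, ωv⟩ h ⊓
      (S.coveringGraph.branchSubgroup ⟨b', ω'⟩ ⟨v, ωv⟩ h').map (MulAut.conj g).toMonoidHom = ⊥ := by
  set θ := S.conjugator h
  set θ' := S.conjugator h'
  set g₀ : 𝒢.Gv v := θ⁻¹ * (g : 𝒢.Gv v) * θ'
  have hup : 𝒢.branchSubgroup b v (S.abuts_of_coveringAbuts h) ⊓
      (𝒢.branchSubgroup b' v (S.abuts_of_coveringAbuts h')).map (MulAut.conj g₀).toMonoidHom = ⊥ :=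
    (hE (𝒢.graph.edgeOf b)).2 b rfl v (S.abuts_of_coveringAbuts h) b' (S.abuts_of_coveringAbuts h') g₀
      (S.base_side_condition h h' g hside)
  rw [eq_bot_iff]
  rintro x ⟨hx, hx'⟩
  obtain ⟨y, hy, rfl⟩ := hx'
  rw [Subgroup.mem_bot]
  -- `θ⁻¹ x θ ∈ Π_b ⊓ g₀ Π_{b'} g₀⁻¹ = ⊥`
  have h1 : θ⁻¹ * ((MulAut.conj g).toMonoidHom y : 𝒢.Gv v) * θ ∈
      𝒢.branchSubgroup b v (S.abuts_of_coveringAbuts h) :=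
    S.coe_mem_conj_branchSubgroup_of_mem h hx
  have h2 : θ⁻¹ * ((MulAut.conj g).toMonoidHom y : 𝒢.Gv v) * θ ∈
      (𝒢.branchSubgroup b' v (S.abuts_of_coveringAbuts h')).map (MulAut.conj g₀).toMonoidHom := by
    refine ⟨θ'⁻¹ * (y : 𝒢.Gv v) * θ', S.coe_mem_conj_branchSubgroup_of_mem h' hy, ?_⟩
    simp only [MulEquiv.toMonoidHom_eq_coe, MonoidHom.coe_coe, MulAut.conj_apply, g₀,
      Subgroup.coe_mul, Subgroup.coe_inv]
    group
  have h12 : θ⁻¹ * ((MulAut.conj g).toMonoidHom y : 𝒢.Gv v) * θ = 1 := by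
    rw [← Subgroup.mem_bot, ← hup]
    exact ⟨h1, h2⟩
  apply Subtype.ext
  change ((MulAut.conj g).toMonoidHom y : 𝒢.Gv v) = 1
  calc ((MulAut.conj g).toMonoidHom y : 𝒢.Gv v)
      = θ * (θ⁻¹ * ((MulAut.conj g).toMonoidHom y : 𝒢.Gv v) * θ) * θ⁻¹ := by group
    _ = 1 := by rw [h12]; group

/-! ### Aloofness is hereditary -/

/-- **Aloofness is hereditary** ([SemiAnbd] Rmk. 2.4.1), one pair of branches: the infinite relative
index descends because the branch group of `G_S` has finite index in the conjugate of `Π_b`.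
[cite: MochizukiSemiAnbd2006, Rmk 2.4.1 p.26] -/
theorem relIndex_branchSubgroup_map_conj_eq_zero (hA : 𝒢.IsTotallyAloof)
    {b b' : 𝒢.graph.Branch} {ω : BTemp.Orbits (S.SE (𝒢.graph.edgeOf b))}
    {ω' : BTemp.Orbits (S.SE (𝒢.graph.edgeOf b'))} {v : 𝒢.graph.Vertex} {ωv : BTemp.Orbits (S.SV v)}
    (h : S.coveringSemiGraph.abuts ⟨b, ω⟩ = some ⟨v, ωv⟩)
    (h' : S.coveringSemiGraph.abuts ⟨b', ω'⟩ = some ⟨v, ωv⟩)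
    (g : BTemp.stab (S.SV v) (Quot.out ωv))
    (hside : (⟨b', ω'⟩ : S.coveringSemiGraph.Branch) ≠ ⟨b, ω⟩ ∨
      g ∉ S.coveringGraph.branchSubgroup ⟨b, ω⟩ ⟨v, ωv⟩ h) :
    ((S.coveringGraph.branchSubgroup ⟨b', ω'⟩ ⟨v, ωv⟩ h').map (MulAut.conj g).toMonoidHom).relIndex
      (S.coveringGraph.branchSubgroup ⟨b, ω⟩ ⟨v, ωv⟩ h) = 0 := by
  set θ := S.conjugator h
  set θ' := S.conjugator h'
  set g₀ : 𝒢.Gv v := θ⁻¹ * (g : 𝒢.Gv v) * θ'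
  set F := (BTemp.stab (S.SV v) (Quot.out ωv)).subtype
  have hF : Function.Injective F := Subtype.val_injective
  -- upstairs aloofness at `(b, b', g₀)`, conjugated by `θ`
  set K := (𝒢.branchSubgroup b v (S.abuts_of_coveringAbuts h)).map (MulAut.conj θ).toMonoidHom
  set H := ((𝒢.branchSubgroup b' v (S.abuts_of_coveringAbuts h')).map
    (MulAut.conj g₀).toMonoidHom).map (MulAut.conj θ).toMonoidHom
  have hup : H.relIndex K = 0 := by
    rw [Subgroup.relIndex_map_map_of_injective _ _ (MulAut.conj θ).injective]
    exact hA (𝒢.graph.edgeOf b) b rfl v (S.abuts_of_coveringAbuts h) b' (S.abuts_of_coveringAbuts h') g₀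
      (S.base_side_condition h h' g hside)
  -- downstairs groups pushed into `Π_v`
  set Kd := S.coveringGraph.branchSubgroup ⟨b, ω⟩ ⟨v, ωv⟩ h
  set Hd := (S.coveringGraph.branchSubgroup ⟨b', ω'⟩ ⟨v, ωv⟩ h').map (MulAut.conj g).toMonoidHom
  have hK₁ : Kd.map F ≤ K := by
    rintro _ ⟨x, hx, rfl⟩
    refine ⟨θ⁻¹ * (x : 𝒢.Gv v) * θ, S.coe_mem_conj_branchSubgroup_of_mem h hx, ?_⟩
    simp only [MulEquiv.toMonoidHom_eq_coe, MonoidHom.coe_coe, MulAut.conj_apply, F,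
      Subgroup.coe_subtype]
    group
  have hH₁ : Hd.map F ≤ H := by
    rintro _ ⟨_, ⟨y, hy, rfl⟩, rfl⟩
    refine ⟨g₀ * (θ'⁻¹ * (y : 𝒢.Gv v) * θ') * g₀⁻¹,
      ⟨θ'⁻¹ * (y : 𝒢.Gv v) * θ', S.coe_mem_conj_branchSubgroup_of_mem h' hy, rfl⟩, ?_⟩
    simp only [MulEquiv.toMonoidHom_eq_coe, MonoidHom.coe_coe, MulAut.conj_apply, F, g₀,
      Subgroup.coe_subtype, Subgroup.coe_mul, Subgroup.coe_inv]
    group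
  have hfin : (Kd.map F).relIndex K ≠ 0 := S.relIndex_map_branchSubgroup_ne_zero h
  rw [← Subgroup.relIndex_map_map_of_injective Hd Kd hF]
  exact relIndex_eq_zero_of_finite_sub (Subgroup.relIndex_eq_zero_of_le_left hH₁ hup) hK₁ hfin

/-- **[SemiAnbd] Rmk. 2.4.1, aloofness clause, for covering semi-graphs:** if `G` is totally aloof
then so is the covering semi-graph of anabelioids `G_S` of every object `S` of `B^cov(G)`.
[cite: MochizukiSemiAnbd2006, Rmk 2.4.1 p.26] -/
theorem isTotallyAloof_coveringGraph (hA : 𝒢.IsTotallyAloof) : S.coveringGraph.IsTotallyAloof := by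
  rintro ⟨e, ωe⟩ ⟨b, ω⟩ _ ⟨v, ωv⟩ h ⟨b', ω'⟩ h' g hside
  exact S.relIndex_branchSubgroup_map_conj_eq_zero hA h h' g hside

/-- **[SemiAnbd] Rmk. 2.4.1, estrangement clause, for covering semi-graphs:** if `G` is totally
estranged then so is the covering semi-graph of anabelioids `G_S` of every object `S` of `B^cov(G)`.
[cite: MochizukiSemiAnbd2006, Rmk 2.4.1 p.26] -/
theorem isTotallyEstranged_coveringGraph (hE : 𝒢.IsTotallyEstranged) :
    S.coveringGraph.IsTotallyEstranged := by
  rintro ⟨e, ωe⟩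
  refine ⟨?_, ?_⟩
  · rintro ⟨b, ω⟩ _ ⟨v, ωv⟩ h ⟨b', ω'⟩ h' g hside
    exact S.relIndex_branchSubgroup_map_conj_eq_zero (fun e => (hE e).1) h h' g hside
  · rintro ⟨b, ω⟩ _ ⟨v, ωv⟩ h ⟨b', ω'⟩ h' g hside
    exact S.inf_branchSubgroup_map_conj_eq_bot hE h h' g hside

end CovObj

end ProfiniteSemiGraph

end Literature.AnabelianGeometry.SemiGraphs
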